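import Literature.NumberTheory.Automorphic.UnboundedDenominatorsAssemblyInputsProofs
import Literature.NumberTheory.Automorphic.UnboundedDenominatorsLambdaFieldProofs
import HarnessLib

/-!
# The unbounded denominators theorem (Calegari–Dimitrov–Tang) — §6.3: the finiteness input as `[R_N : M_2] < ∞`

PROOF-ONLY sequel (no definition, no named fact; D-0026) of
`UnboundedDenominatorsAssemblyInputsProofs.lean` (`…of_printed_inputs`) and
`UnboundedDenominatorsLambdaFieldProofs.lean` (`M_2 = ℂ(λ)`). Source: F. Calegari, V. Dimitrov,
Y. Tang, *The unbounded denominators conjecture*, J. Amer. Math. Soc. **38** (2025), 627–702 =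
arXiv:2109.09040, Lemma 4.2.2 ("`M_N` and `R_N` have finite dimensions over `M_2 = ℚ(λ)`" — from the
holonomy bound) and §6.3.

The assembled theorem `CalegariDimitrovTang2025_unboundedDenominators.of_printed_inputs` took the
finiteness in processed form (`(bddDenField N).FG` and `0 < [R_{N'} : M_N]`). Here both are derived
from the single printed statement **`[R_N : M_2] < ∞`** (`0 < relfinrank (levelField 2) (bddDenField N)`)
for even `N`, using `M_2 = ℂ(λ)`:

* `relfinrank_levelField_pos_of_two` — `0 < [R_{N'} : M_N]` for even `N ∣ N'` (a divisor of
  `[R_{N'} : M_2]`);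
* `fg_bddDenField_of_relfinrank_pos` — `R_N` is finitely generated over `ℂ` (by `λ` and an
  `M_2`-basis);
* ★ `CalegariDimitrovTang2025_unboundedDenominators.of_printed_inputs'` — Theorem 1.0.1 from
  `hker₂`, `hcor`, Shimura 3.52, **`[R_N : M_2] < ∞` (even `N`)**, (4.3.3) `[M_N : M_2] ≥ c N³`, and
  Proposition 3.0.1 `[R_N : M_2] ≤ C N³ log N`.

## References

* [CalegariDimitrovTang2025] F. Calegari, V. Dimitrov, Y. Tang, The unbounded denominators
  conjecture, J. Amer. Math. Soc. 38 (2025), no. 3, 627–702; arXiv:2109.09040. Lemma 4.2.2, §4.3,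
  §6.3.
-/

noncomputable section

namespace Literature.NumberTheory.Automorphic

open scoped MatrixGroups ModularForm Manifold
open UpperHalfPlane CongruenceSubgroup Matrix.SpecialLinearGroup ModularGroup

namespace UnboundedDenominators

/-! ### §1. From `[R_N : M_2] < ∞` to the processed finiteness inputs -/

/-- **`0 < [R_{N'} : M_N]` from `0 < [R_{N'} : M_2]`** for even `N` dividing `N'`
(`[R_{N'} : M_N]` divides `[R_{N'} : M_2]`). [cite: CalegariDimitrovTang2025, Lemma 4.2.2] -/
theorem relfinrank_levelField_pos_of_two {N N' : ℕ} (hN : 0 < N) (heven : Even N) (hd : N ∣ N')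
    (h2 : 0 < IntermediateField.relfinrank (levelField 2) (bddDenField N')) :
    0 < IntermediateField.relfinrank (levelField N) (bddDenField N') := by
  have h2N : levelField 2 ≤ levelField N := levelField_mono two_pos heven.two_dvd hN.ne'
  have _ := hd
  exact Nat.pos_of_dvd_of_pos (IntermediateField.relfinrank_dvd_of_le_left (bddDenField N') h2N) h2

/-- **`R_N` is finitely generated over `ℂ` when `[R_N : M_2] < ∞`** (even `N > 0`): it is generated by
`λ` (as `M_2 = ℂ(λ)`, `levelField_two_eq_adjoin`) and an `M_2`-basis of `R_N`.
[cite: CalegariDimitrovTang2025, Lemma 4.2.2 and Lemma 4.2.3] -/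
theorem fg_bddDenField_of_relfinrank_pos {N : ℕ} (hN : 0 < N) (heven : Even N)
    (h2 : 0 < IntermediateField.relfinrank (levelField 2) (bddDenField N)) :
    (bddDenField N).FG := by
  classical
  have hKE : levelField 2 ≤ bddDenField N :=
    (levelField_mono two_pos heven.two_dvd hN.ne').trans (levelField_le_bddDenField N)
  rw [IntermediateField.relfinrank_eq_finrank_of_le hKE] at h2
  haveI : Module.Free (levelField 2) (IntermediateField.extendScalars hKE) :=
    Module.Free.of_divisionRing _ _
  haveI : Module.Finite (levelField 2) (IntermediateField.extendScalars hKE) :=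
    Module.finite_of_finrank_pos h2
  let b := Module.finBasis (levelField 2) (IntermediateField.extendScalars hKE)
  obtain ⟨L, -, hL⟩ := levelField_two_eq_adjoin
  set lam : Mer := algebraMap hol Mer L with hlam
  -- `R_N = ℂ(λ, b₁, …, b_d)`
  let S : Set Mer := insert lam (Set.range fun i ↦ ((b i : IntermediateField.extendScalars hKE) : Mer))
  have hS : S.Finite := (Set.finite_range _).insert lam
  suffices heq : bddDenField N = IntermediateField.adjoin ℂ S by
    rw [heq]
    exact IntermediateField.fg_adjoin_of_finite hS
  refine le_antisymm ?_ (IntermediateField.adjoin_le_iff.mpr ?_)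
  · intro x hx
    -- expand `x` on the basis `b` with coefficients in `M_2 = ℂ(λ) ≤ ℂ(S)`
    have hK : levelField 2 ≤ IntermediateField.adjoin ℂ S := by
      rw [hL]
      exact IntermediateField.adjoin.mono ℂ _ _ (Set.singleton_subset_iff.mpr (Set.mem_insert _ _))
    let y : IntermediateField.extendScalars hKE := ⟨x, hx⟩
    have hx' : x = ∑ i, ((b.repr y i : levelField 2) : Mer) *
        ((b i : IntermediateField.extendScalars hKE) : Mer) := by
      calc x = ((y : IntermediateField.extendScalars hKE) : Mer) := rfl
        _ = ((∑ i, b.repr y i • b i : IntermediateField.extendScalars hKE) : Mer) := by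
            rw [b.sum_repr y]
        _ = ∑ i, ((b.repr y i • b i : IntermediateField.extendScalars hKE) : Mer) :=
            AddSubmonoidClass.coe_finsetSum _ _
        _ = ∑ i, ((b.repr y i : levelField 2) : Mer) *
              ((b i : IntermediateField.extendScalars hKE) : Mer) := by
            refine Finset.sum_congr rfl fun i _ ↦ ?_
            rw [IntermediateField.coe_smul, IntermediateField.smul_def, smul_eq_mul]
    rw [hx']
    refine sum_mem fun i _ ↦ mul_mem (hK (b.repr y i).2) ?_
    exact IntermediateField.subset_adjoin ℂ _ (Set.mem_insert_of_mem _ (Set.mem_range_self i))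
  · intro y hy
    rcases Set.mem_insert_iff.mp hy with rfl | ⟨i, rfl⟩
    · rw [hlam]
      have : algebraMap hol Mer L ∈ levelField 2 := by
        rw [hL]
        exact IntermediateField.subset_adjoin ℂ _ (Set.mem_singleton _)
      exact hKE this
    · exact (b i).2

/-! ### §2. Theorem 1.0.1 with the finiteness input in printed form -/

/-- ★ **CDT Theorem 1.0.1 from its printed inputs, finiteness as `[R_N : M_2] < ∞`**
[cite: CalegariDimitrovTang2025, §6.3 and Lemma 4.2.2]: the named fact
`CalegariDimitrovTang2025_unboundedDenominators` follows from (1) `hker₂` (amalgam + congruence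
subgroup property of `SL₂(ℤ[1/p])`, for `N > 0`, `p ∤ N`), (2) `hcor` (Corollary 4.5.3), (3) Shimura's
Theorem 3.52 for `Γ(N)`, (4) **`[R_N : M_2] < ∞` for even `N`** (Lemma 4.2.2: "`R_N` has finite
dimension over `M_2 = ℚ(λ)`", from the holonomy bound), (5) (4.3.3) `[M_N : M_2] ≥ c N³` and
(6) Proposition 3.0.1 `[R_N : M_2] ≤ C N³ log N`, for even `N`. -/
theorem _root_.Literature.NumberTheory.Automorphic.CalegariDimitrovTang2025_unboundedDenominators.of_printed_inputs'
    (hker₂ : ∀ (N p : ℕ) (A : GL (Fin 2) ℝ), 0 < N →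
      (A : Matrix (Fin 2) (Fin 2) ℝ) = !![(p : ℝ), 0; 0, 1] → p.Prime → ¬ p ∣ N →
      ∀ (Δ : Type) [Group Δ] [Finite Δ] (g₁ g₂ : Gamma N →* Δ),
      (∀ (x : SL(2, ℤ)) (hx : x ∈ Gamma N), x ∈ Gamma0 p → ∀ (y : SL(2, ℤ)) (hy : y ∈ Gamma N),
        A * mapGL ℝ x = mapGL ℝ y * A → g₁ ⟨x, hx⟩ = g₂ ⟨y, hy⟩) →
      (∃ M : ℕ, M ≠ 0 ∧ ∀ (x : SL(2, ℤ)) (hx : x ∈ Gamma N), x ∈ Gamma M → g₁ ⟨x, hx⟩ = 1) ∧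
      (∃ M : ℕ, M ≠ 0 ∧ ∀ (x : SL(2, ℤ)) (hx : x ∈ Gamma N), x ∈ Gamma M → g₂ ⟨x, hx⟩ = 1))
    (hcor : ∀ (N : ℕ) (Q : Type) [CommGroup Q] [Finite Q] (θ : Gamma N →* Q),
      (∀ g : SL(2, ℤ), ∃ M : ℕ, M ≠ 0 ∧ ∀ (x : SL(2, ℤ)) (hx : x ∈ Gamma N)
        (hgx : g * x * g⁻¹ ∈ Gamma N), x ∈ Gamma M → θ ⟨g * x * g⁻¹, hgx⟩ = θ ⟨x, hx⟩) →
      ∃ M : ℕ, M ≠ 0 ∧ ∀ (x : SL(2, ℤ)) (hx : x ∈ Gamma N), x ∈ Gamma M → θ ⟨x, hx⟩ = 1)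
    (hShimura : ∀ (N : ℕ), 0 < N → ∀ (m : ℕ)
      (F : ModularForm ((Gamma N : Subgroup SL(2, ℤ)) : Subgroup (GL (Fin 2) ℝ)) (12 * (m : ℤ))),
      ∃ (ι : Type) (_ : Fintype ι) (c : ι → ℂ)
      (B : ι → ModularForm ((Gamma N : Subgroup SL(2, ℤ)) : Subgroup (GL (Fin 2) ℝ)) (12 * (m : ℤ))),
      (∀ i (n : ℕ), ∃ z : ℤ, PowerSeries.coeff n (qExpansion (N : ℝ) (B i)) = (z : ℂ)) ∧
      (F : ℍ → ℂ) = ∑ i, c i • (B i : ℍ → ℂ))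
    (hfin : ∀ N : ℕ, 0 < N → Even N → 0 < IntermediateField.relfinrank (levelField 2) (bddDenField N))
    (hdeg : ∃ c : ℝ, 0 < c ∧ ∀ N : ℕ, 0 < N → Even N →
      c * (N : ℝ) ^ 3 ≤ IntermediateField.relfinrank (levelField 2) (levelField N))
    (hhol : ∃ C : ℝ, ∀ N : ℕ, 0 < N → Even N →
      (IntermediateField.relfinrank (levelField 2) (bddDenField N) : ℝ) ≤ C * (N : ℝ) ^ 3 * Real.log N) :
    CalegariDimitrovTang2025_unboundedDenominators := by
  obtain ⟨c, hc, hdeg⟩ := hdeg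
  obtain ⟨C, hhol⟩ := hhol
  refine CalegariDimitrovTang2025_unboundedDenominators.of_bddDenField_le_levelField
    fun N hN heven ↦ ?_
  let S : Set ℕ := {N | 0 < N ∧ Even N}
  have hS : ∀ N ∈ S, ∀ p : ℕ, p.Prime → ¬ p ∣ N → N * p ∈ S := fun N hNS p hp _ ↦
    ⟨Nat.mul_pos hNS.1 hp.pos, hNS.2.mul_right p⟩
  let r : ℕ → ℕ := fun N ↦ IntermediateField.relfinrank (levelField N) (bddDenField N)
  have hdouble : ∀ N ∈ S, ∀ p : ℕ, p.Prime → ¬ p ∣ N → 1 < r N → 2 * r N ≤ r (N * p) := by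
    intro N hNS p hp hpN h1
    obtain ⟨A, hA⟩ : ∃ A : GL (Fin 2) ℝ, (A : Matrix (Fin 2) (Fin 2) ℝ) = !![(p : ℝ), 0; 0, 1] :=
      ⟨Matrix.GeneralLinearGroup.mkOfDetNeZero !![(p : ℝ), 0; 0, 1]
        (by rw [Matrix.det_fin_two_of]; simp [hp.ne_zero]), rfl⟩
    have hNp : N.Coprime p := ((Nat.Prime.coprime_iff_not_dvd hp).mpr hpN).symm
    have hNp0 : 0 < N * p := Nat.mul_pos hNS.1 hp.pos
    have hNpS : N * p ∈ S := hS N hNS p hp hpN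
    have hne : bddDenField N ≠ levelField N := by
      intro heq
      have : r N = 1 := by
        change IntermediateField.relfinrank (levelField N) (bddDenField N) = 1
        rw [heq, IntermediateField.relfinrank_self]
      omega
    exact two_mul_relfinrank_le hNS.1.ne' hp hNp hA (hker₂ N p A hNS.1 hA hp hpN) (hcor N)
      (hrat_of_forall_exists_sum hNS.1 (hShimura N hNS.1))
      (hrat_of_forall_exists_sum hNp0 (hShimura (N * p) hNp0))
      (fg_bddDenField_of_relfinrank_pos hNS.1 hNS.2 (hfin N hNS.1 hNS.2))
      (relfinrank_levelField_pos_of_two hNS.1 hNS.2 (dvd_mul_right N p)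
        (hfin (N * p) hNpS.1 hNpS.2)) hne
  have hle : r N ≤ 1 :=
    CalegariDimitrovTang2025_unboundedDenominators.le_one_of_log_bound_of_doubling hS r (C / c)
      (fun N hNS ↦ log_gap_of_degree_bounds hc hdeg hhol N hNS.1 hNS.2) hdouble N ⟨hN, heven⟩
      hN.ne'
  have hpos : 0 < r N := relfinrank_levelField_pos_of_two hN heven dvd_rfl (hfin N hN heven)
  have h1 : IntermediateField.relfinrank (levelField N) (bddDenField N) = 1 := by
    change r N = 1
    omega
  exact IntermediateField.relfinrank_eq_one_iff.mp h1

end UnboundedDenominators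


end Literature.NumberTheory.Automorphic

end
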